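import Literature.AnabelianGeometry.AbsoluteAnabelian.AbsTopIII.KummerFaithful
import Literature.FieldTheory.Regular.FiniteAlgebraicClosureAnyChar
import Literature.NumberTheory.DiophantineGeometry.FunctionFieldPointCountRationalProofs
import Literature.NumberTheory.DiophantineGeometry.FunctionFieldSchmidtDegreeOneExtensionProofs
import Literature.NumberTheory.DiophantineGeometry.FunctionFieldGenusRiemannRochProofs
import Literature.NumberTheory.DiophantineGeometry.FunctionFieldGenusApproximationProofs
import HarnessLib

/-!
# [AbsTopIII] Rmk. 1.5.4 (ii), torus part: finitely generated extensions of torally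
Kummer-faithful fields — proof

Mochizuki, *Topics in Absolute Anabelian Geometry III*, §1, Remark 1.5.4 (ii), p. 34 of the
author's manuscript (lit key `paper:url-5493eb38cbb7`; journal pagination not held): "every
finitely generated extension of a Kummer-faithful field (respectively, torally Kummer-faithful
field) is itself Kummer-faithful (respectively, torally Kummer-faithful)" — "in the case of
'torally Kummer-faithful', one reduces immediately [...] to the case of `𝔾_m`, in which case the
desired injectivity is an easy consequence of the elementary theory of discrete valuations".
This PROOF-ONLY companion of `AbsTopIII/KummerFaithful.lean` (statements by abc-iut-L4-t1,
p404026; sibling companion `KummerFaithfulProofs` = Rmk. 1.5.3 (i) by abc-iut-L4-t16) DISCHARGES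
the named fact `Rmk_1_5_4_ii` exactly as typed there (`IsTorallyKummerFaithful k`, `L/k` finitely
generated ⟹ `IsTorallyKummerFaithful L`).

## Proof ("the elementary theory of discrete valuations", made explicit)

Let `L'` be a finite extension of `L`; it is finitely generated over `k`.  Let `x ∈ L'^×` admit
an `n`-th root `y_n ∈ L'` for every `n ≥ 1`.
* `x` is ALGEBRAIC over `k` (`isAlgebraic_of_forall_exists_pow`): otherwise `k(x)/k` is a
  rational function field and `M :=` the algebraic closure of `k(x)` in `L'` is a FINITE
  extension of `k(x)` (the relative algebraic closure in a finitely generated extension is finite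
  — Serre 1958/59, Lang; tree `Literature.FieldTheory.Regular.finiteDimensional_algebraicClosure`),
  hence an algebraic function field of one variable over `k` (tree
  `isAlgFunctionField_adjoin_simple`, `isAlgFunctionField_of_finiteDimensional`) containing every
  `y_n` (as `y_n^n = x ∈ k(x)`); the transcendental element `x` has a pole at some place `v` of
  `M/k` (Stichtenoth Cor. 1.1.20, tree `exists_placeOver_not_mem`), but
  `ord_v x = n · ord_v y_n` for all `n` forces `ord_v x = 0` — contradiction.
* Hence `x`, and likewise every `y_n`, lies in `F₁ :=` the algebraic closure of `k` in `L'`,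
  which is a FINITE extension of `k` (Serre/Lang again); so `x` is infinitely divisible in `F₁^×`
  and `x = 1` because `k` is torally Kummer-faithful.

No new definitions.  Nothing here bears on the disputed parts of IUT; this is a kernel check of a
classical statement about multiplicative groups of finitely generated fields (cf. May 1972).
-/

noncomputable section

open scoped Classical IntermediateField

namespace Literature.AnabelianGeometry.AbsoluteAnabelian.AbsTopIII

open Literature.NumberTheory.DiophantineGeometry
open Literature.NumberTheory.DiophantineGeometry.AlgFunctionField

universe u v w

/-- In an algebraic function field of one variable `F/K`, a nonzero element admitting an `n`-th
root for every `n ≥ 1` is algebraic over `K`: a transcendental element has a pole `v`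
(Stichtenoth Cor. 1.1.20), and `ord_v (yⁿ) = n · ord_v y` would make `ord_v x` divisible by
every `n`. [cite: Stichtenoth2009, Cor. 1.1.20] -/
private theorem isAlgebraic_of_forall_exists_pow_of_isAlgFunctionField {K : Type v} {F : Type w}
    [Field K] [Field F] [Algebra K F] [IsAlgFunctionField K F] {x : F} (hx0 : x ≠ 0)
    (hdiv : ∀ n : ℕ, 0 < n → ∃ y : F, y ^ n = x) : IsAlgebraic K x := by
  by_contra htr
  obtain ⟨v, hv⟩ := exists_placeOver_not_mem (K := K) (F := F) (show Transcendental K x from htr)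
  have hneg : ¬ 0 ≤ v.ord x := fun h ↦ hv ((v.mem_toValuationSubring_iff_ord_nonneg hx0).2 h)
  obtain ⟨y, hy⟩ := hdiv ((v.ord x).natAbs + 1) (Nat.succ_pos _)
  have hy0 : y ≠ 0 := by
    rintro rfl
    exact hx0 (by rw [← hy, zero_pow (Nat.succ_ne_zero _)])
  have hdvd : (((v.ord x).natAbs + 1 : ℕ) : ℤ) ∣ v.ord x :=
    ⟨v.ord y, by rw [← v.ord_pow hy0, hy]⟩
  have h0 : v.ord x = 0 :=
    Int.eq_zero_of_dvd_of_natAbs_lt_natAbs hdvd (by rw [Int.natAbs_natCast]; omega)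
  exact hneg h0.ge

/-- **Infinitely divisible elements of a finitely generated field extension are algebraic over
the base**: if `E/k` is finitely generated and `0 ≠ x ∈ E` has an `n`-th root in `E` for every
`n ≥ 1`, then `x` is algebraic over `k` (reduction to the function field
`M = (k(x))^{alg ∩ E} ⊇ k(x)`, finite over `k(x)` by Serre's lemma, which contains all the roots).
[cite: MochizukiAbsTopIII2015, Rmk 1.5.4 (ii) p.34] -/
private theorem isAlgebraic_of_forall_exists_pow {k : Type u} {E : Type v} [Field k] [Field E]
    [Algebra k E] [Algebra.EssFiniteType k E] {x : E} (hx0 : x ≠ 0)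
    (hdiv : ∀ n : ℕ, 0 < n → ∃ y : E, y ^ n = x) : IsAlgebraic k x := by
  by_contra htr
  have htr' : Transcendental k x := htr
  -- `K₀ = k(x)`, a rational function field
  set K₀ : IntermediateField k E := k⟮x⟯ with hK₀
  haveI : IsAlgFunctionField k K₀ := isAlgFunctionField_adjoin_simple htr'
  haveI : Algebra.EssFiniteType K₀ E := Algebra.EssFiniteType.of_comp k K₀ E
  -- `M` = algebraic closure of `k(x)` in `E`, finite over `k(x)`, a function field over `k`
  set M : IntermediateField K₀ E := algebraicClosure K₀ E with hM
  haveI : FiniteDimensional K₀ M :=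
    Literature.FieldTheory.Regular.finiteDimensional_algebraicClosure
  haveI : IsAlgFunctionField k M :=
    isAlgFunctionField_of_finiteDimensional (K := k) (F := K₀) (F' := M)
  have hxK₀ : x ∈ K₀ := IntermediateField.mem_adjoin_simple_self k x
  have hxalgK₀ : IsAlgebraic K₀ x := by
    have h := isAlgebraic_algebraMap (R := K₀) (A := E) (⟨x, hxK₀⟩ : K₀)
    exact h
  have hxM : x ∈ M := by
    rw [hM, mem_algebraicClosure_iff]
    exact hxalgK₀
  set xM : M := ⟨x, hxM⟩ with hxMdef
  have hxM0 : xM ≠ 0 := fun h ↦ hx0 (congrArg Subtype.val h)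
  have hdivM : ∀ n : ℕ, 0 < n → ∃ y : M, y ^ n = xM := by
    intro n hn
    obtain ⟨y, hy⟩ := hdiv n hn
    have hyM : y ∈ M := by
      rw [hM, mem_algebraicClosure_iff]
      refine IsAlgebraic.of_pow hn ?_
      rw [hy]
      exact hxalgK₀
    exact ⟨⟨y, hyM⟩, Subtype.ext hy⟩
  have halg : IsAlgebraic k xM :=
    isAlgebraic_of_forall_exists_pow_of_isAlgFunctionField (K := k) hxM0 hdivM
  haveI : IsScalarTower k M E := IsScalarTower.of_algebraMap_eq fun _ ↦ rfl
  exact htr (halg.algebraMap (A := E))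

/-- **DISCHARGE of `Rmk_1_5_4_ii`** ([AbsTopIII] Rmk. 1.5.4 (ii) p. 34, torus part): a finitely
generated extension `L` of a torally Kummer-faithful field `k` is torally Kummer-faithful —
for every finite extension `L'/L` one has `⋂_N (L'^×)^N = {1}`.  Proof: an infinitely divisible
`x ∈ L'^×` and all its roots are algebraic over `k` (`isAlgebraic_of_forall_exists_pow`), i.e.
lie in the relative algebraic closure `F₁` of `k` in `L'`, which is finite over `k`
(Serre/Lang, tree `finiteDimensional_algebraicClosure`), where the hypothesis on `k` applies.
[cite: MochizukiAbsTopIII2015, Rmk 1.5.4 (ii) p.34] -/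
theorem Rmk_1_5_4_ii_holds : Rmk_1_5_4_ii.{u} := by
  intro k _ L _ _ hfg hk
  haveI : CharZero k := hk.charZero
  refine ⟨charZero_of_injective_algebraMap (algebraMap k L).injective, fun L' _ _ hfin ↦ ?_⟩
  -- `L'` as a finitely generated extension of `k`
  letI : Algebra k L' := Algebra.compHom L' (algebraMap k L)
  haveI : IsScalarTower k L L' := IsScalarTower.of_algebraMap_eq fun _ ↦ rfl
  haveI : Algebra.EssFiniteType k L := IntermediateField.fg_top_iff.mp hfg
  haveI : Module.Finite L L' := hfin
  haveI : Algebra.EssFiniteType L L' := inferInstance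
  haveI : Algebra.EssFiniteType k L' := Algebra.EssFiniteType.comp k L L'
  -- `F₁` = algebraic closure of `k` in `L'`, finite over `k`, hence satisfies condition (a)
  set F₁ : IntermediateField k L' := algebraicClosure k L' with hF₁
  haveI : FiniteDimensional k F₁ :=
    Literature.FieldTheory.Regular.finiteDimensional_algebraicClosure
  have hF₁a : DivisibleElementsTrivial F₁ˣ := hk.units F₁ inferInstance
  refine ⟨fun x hx ↦ ?_⟩
  -- `x` and all its roots are algebraic over `k`
  have hxalg : IsAlgebraic k (x : L') := by
    refine isAlgebraic_of_forall_exists_pow x.ne_zero fun n hn ↦ ?_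
    obtain ⟨y, hy⟩ := hx n hn
    exact ⟨y, by rw [← Units.val_pow_eq_pow_val, hy]⟩
  have hmem : ∀ (z : L'ˣ) (n : ℕ), 0 < n → z ^ n = x → (z : L') ∈ F₁ := fun z n hn hz ↦ by
    rw [hF₁, mem_algebraicClosure_iff]
    refine IsAlgebraic.of_pow hn ?_
    rw [← Units.val_pow_eq_pow_val, hz]
    exact hxalg
  -- lift `x` and its roots to `F₁ˣ`
  let lift : ∀ (z : L'ˣ) (n : ℕ), 0 < n → z ^ n = x → F₁ˣ := fun z n hn hz ↦
    Units.mk0 ⟨(z : L'), hmem z n hn hz⟩ (fun h ↦ z.ne_zero (congrArg Subtype.val h))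
  have hlift : ∀ z n hn hz, ((lift z n hn hz : F₁) : L') = (z : L') := fun _ _ _ _ ↦ rfl
  have hx₁one : lift x 1 one_pos (pow_one x) = 1 := by
    refine hF₁a.eq_one_of_forall_exists_pow _ fun n hn ↦ ?_
    obtain ⟨y, hy⟩ := hx n hn
    refine ⟨lift y n hn hy, ?_⟩
    apply Units.ext
    apply Subtype.ext
    change (((lift y n hn hy ^ n : F₁ˣ) : F₁) : L') = ((lift x 1 one_pos (pow_one x) : F₁) : L')
    rw [Units.val_pow_eq_pow_val, SubmonoidClass.coe_pow, hlift y n hn hy,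
      hlift x 1 one_pos (pow_one x), ← Units.val_pow_eq_pow_val, hy]
  have hval : ((lift x 1 one_pos (pow_one x) : F₁) : L') = (x : L') := hlift x 1 one_pos (pow_one x)
  apply Units.ext
  rw [← hval, hx₁one]
  simp

end Literature.AnabelianGeometry.AbsoluteAnabelian.AbsTopIII
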